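import Summits.ResolutionOfSingularities.ResolutionOfSingularities.Theorems.FrobeniusLadderFInjectiveMacaulayficationAffineBlowupChartTransport
import Summits.ResolutionOfSingularities.ResolutionOfSingularities.Theorems.FrobeniusLadderFInjectiveMacaulayficationIdealSheafOfPointClosure
import HarnessLib

/-!
# [OURS · L1 W4.5a] E7 R3 (generic half) `AffineBlowupChartRestriction` — the ideal of the bad curve `closure {ξ}` on EVERY Rees
# chart of `Bl_I(Spec R)` from the defining chart: the RESTRICTION LEMMA behind the cert's `restriction_certificates`, with no
# chart transition and no localisation identity — only point readings

Crux `FrobeniusLadder.FInjectiveMacaulayfication` = stmt-ResolutionOfSingularities-15315 (chain w45a), hole 5e, E7 instance layer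
(res-L1-w45a-plan-1 R12.60 (4) «res-type-034 := R3 = the instance's bookkeeping lemmas from the cert (restriction certificates ⇒
`J₂.ideal U_c = P_c` …)», E7 CERT FORMAT `two-level-tower-cert-v1` §1 `bad_closed_set.restriction_certificates`; tri-1's
`cert-T11-p3-tower.v1.json` 9b80b52d9fdbabd6). Companion of `AffineBlowupChartTransport` (p530538) and res-type-002's N5b
`IdealSheafOfPointClosure` (p525541). Helper `--supports stmt-ResolutionOfSingularities-15315 --as helper`, typed by res-type-034.
OURS: replaces the role of NOTHING in H. Hironaka's manuscript and is NOT a statement of it; AI-written kernel glue of the cell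
`res-hironaka`, weaker than expert review. No definition, no named fact.

THE POINT. The two-level frame `TwoLevelFrame.pointFixable_of_twoLevelData` (p529483) takes the bad curve as `closure {ξ}` for a point
`ξ` of `X′ = affineBlowup I` and, on every chart `U c`, the guard `¬ 𝓘(closure {ξ}).ideal (U c) ≤ Q`; N5b gives
`𝓘(closure {ξ}).ideal (U c) = 𝔭_ξ` (the prime of `ξ` read in the chart, `IdealSheafOfPointClosure.ideal_eq_primeIdealOf`) when
`ξ ∈ U c` and `= ⊤` otherwise. The instance knows `𝔭_ξ` EXPLICITLY only on the defining chart `D₊(at)` (there `ξ := fromSpec` of the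
cert's prime, §1), and must IDENTIFY `𝔭_ξ` read on another chart `D₊(bt)` with the cert's candidate prime `P ⊆ R[I/b]`. §2 does this
from FOUR finite data, all membership statements in ONE chart ring each (no transition map `y^(64) ↦ y^(c)`, no identity in an overlap
localisation): writing generators in NUMERATOR form `x/(at)ⁿ`, `x/(bt)ⁿ` (`reesChartEquiv (Away.mk n x)`, `x ∈ R[It]ₙ`),
* (h1) each generator `x′_j/(bt)^{m_j}` of `P` has `x′_j/(at)^{m_j} ∈ 𝔭_ξ·e_a` (so `x′_j ∈ ξ`, so the generator lies in `𝔭_ξ·e_b`);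
* (h2) each generator `x_i/(at)^{n_i}` of `𝔭_ξ·e_a` has `x_i/(bt)^{n_i} ∈ P`;
* `P` is prime and `a/b ∉ P`;
then **`𝔭_ξ·e_b = P`** (`map_primeIdealOf_eq_of_memberships`). PROOF of `𝔭_ξ·e_b ≤ P` (the direction that usually costs a
localisation argument): let `η ∈ D₊(bt)` be the point with `𝔭_η·e_b = P` (§1 `exists_map_primeIdealOf_eq`); `a/b ∉ P` puts `η` in
`D(e_b⁻¹(a/b)) = D₊(bt) ⊓ D₊(at)` (`AffineBlowupChartTransport.basicOpen_symm_div_eq_inf`); by (h2) and the point readings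
(`AffineBlowupChartTransport.symm_mk_mem_primeIdealOf_iff`, numerators `x_i ∈ η`) `𝔭_ξ ≤ 𝔭_η` on the chart `D₊(at)`, i.e.
`η ∈ closure {ξ}` (N5b `primeIdealOf_le_iff_mem_closure`), i.e. `𝔭_ξ ≤ 𝔭_η` on the chart `D₊(bt)` as well — which is `𝔭_ξ·e_b ≤ P`.
Also: §1 the DEFINING chart (`exists_point_of_prime`: every prime `Q ⊆ R[I/a]` is `𝔭_ξ·e_a` for a point `ξ ∈ D₊(at)` whose base point
is `Q ∩ R` — the frame's `ξ`, `hξ`), §3 the ideal-sheaf forms (`map_ideal_closure_eq_of_memberships`; charts missing `ξ`: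
`not_mem_basicOpen_iff_div_mem` + N5b `ideal_eq_top`), and §4 the COVER: `exists_mem_of_mem_closure_of_bezout` — `closure {ξ} ⊆ ⋃_{c ∈ S} D₊(x_c t)`
from per-chart Bezout certificates (the cert's `cover_certificates`; the frame's binder `hScover`).
References: The Stacks Project, Tag 0804 (affine blow-up charts), Tag 01J3 (reduced induced structure) — background; folklore.
-/

-- single-problem summit: the doubled namespace component is forced
set_option linter.dupNamespace false

noncomputable section

open AlgebraicGeometry CategoryTheory TopologicalSpace HomogeneousLocalization
open Literature.AlgebraicGeometry.Resolution
open Summit.ResolutionOfSingularities.ResolutionOfSingularities.Theorems.FInjectiveMacaulayfication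

namespace Summit.ResolutionOfSingularities.ResolutionOfSingularities.Theorems.FInjectiveMacaulayfication.AffineBlowupChartRestriction

/-! ## §1 Every prime of the chart model is the prime of a point; the defining chart of `ξ` -/

section Points

universe u v

/-- **Every prime of `B` is the prime of a point of `U`** (any scheme, affine open `U`, `e : Γ(X, U) ≃+* B`): for `𝔔 ⊆ B` prime,
`y := fromSpec (e⁻¹ 𝔔) ∈ U` has `𝔭_y·e = 𝔔`. [folklore] -/
theorem exists_map_primeIdealOf_eq {X : Scheme.{u}} (U : X.affineOpens) {B : Type v} [CommRing B] (e : Γ(X, U) ≃+* B)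
    (𝔔 : PrimeSpectrum B) :
    ∃ (y : X) (hy : y ∈ (U : X.Opens)), (U.2.primeIdealOf ⟨y, hy⟩).asIdeal.map e = 𝔔.asIdeal := by
  let z : PrimeSpectrum Γ(X, U) := ⟨𝔔.asIdeal.comap (e : Γ(X, U) →+* B), inferInstance⟩
  refine ⟨U.2.fromSpec.base z, PointCentreIdealSheaf.fromSpec_mem U.2 z, ?_⟩
  rw [PointCentreIdealSheaf.primeIdealOf_fromSpec U.2 z]
  exact Ideal.map_comap_of_surjective (e : Γ(X, U) →+* B) e.surjective 𝔔.asIdeal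

end Points

section DefiningChart

variable {R : Type} [CommRing R] (I : Ideal R) (a : R) (ha : a ∈ I)

/-- **`𝔭_{x′}·e ∩ R = π(x′)`** on the Rees chart `D₊(at)`, for any `R`-compatible sections isomorphism `e` (N5a `he`, or
`AffineBlowupChartTransport.compat_of_sectionsEquiv_eq`): Mathlib `IsAffineOpen.comap_primeIdealOf_appLE` for `π`, then
`Γ(Spec R, ⊤) ≅ R` via res-type-002's `FibreIdealOfOrigin.primeIdealOf_top_asIdeal`. [folklore] -/
theorem comap_algebraMap_map_primeIdealOf
    (e : Γ(affineBlowup I, Proj.basicOpen (reesGrading I) (reesT a ha)) ≃+* blowupAlgebra I a)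
    (he : ∀ r : R, e ((affineBlowup.π I).appLE ⊤ (Proj.basicOpen (reesGrading I) (reesT a ha)) le_top
      ((Scheme.ΓSpecIso (CommRingCat.of R)).inv r)) = algebraMap R (blowupAlgebra I a) r)
    (x' : ↥(affineBlowup I)) (hx' : x' ∈ Proj.basicOpen (reesGrading I) (reesT a ha)) :
    (((⟨Proj.basicOpen (reesGrading I) (reesT a ha), AffineBlowupChartFrame.isAffineOpen_basicOpen_reesT I a ha⟩ :
        (affineBlowup I).affineOpens).2.primeIdealOf ⟨x', hx'⟩).asIdeal.map e).comap (algebraMap R (blowupAlgebra I a)) =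
      ((affineBlowup.π I).base x').asIdeal := by
  set U : (affineBlowup I).affineOpens :=
    ⟨Proj.basicOpen (reesGrading I) (reesT a ha), AffineBlowupChartFrame.isAffineOpen_basicOpen_reesT I a ha⟩ with hU
  set V : (Spec (CommRingCat.of R)).affineOpens := ⟨⊤, isAffineOpen_top (Spec (CommRingCat.of R))⟩ with hV
  have hUV : (U : (affineBlowup I).Opens) ≤ affineBlowup.π I ⁻¹ᵁ (V : (Spec (CommRingCat.of R)).Opens) := le_top
  set z := U.2.primeIdealOf ⟨x', hx'⟩ with hz
  have hfz : U.2.fromSpec.base z = x' := U.2.fromSpec_primeIdealOf ⟨x', hx'⟩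
  -- the structure map `R → R[I/a]` factors as `e ∘ π.appLE ⊤ U ∘ (ΓSpecIso R)⁻¹`
  have hfac : algebraMap R (blowupAlgebra I a) =
      (e : Γ(affineBlowup I, U) →+* blowupAlgebra I a).comp
        (((affineBlowup.π I).appLE V U hUV).hom.comp (Scheme.ΓSpecIso (CommRingCat.of R)).inv.hom) :=
    RingHom.ext fun r => (he r).symm
  have key : Ideal.comap (e : Γ(affineBlowup I, U) →+* blowupAlgebra I a) (Ideal.map e z.asIdeal) = z.asIdeal :=
    Ideal.comap_map_of_bijective e e.bijective
  have h1 := FibreIdealOfBasePoint.comap_appLE_asIdeal_eq (affineBlowup.π I) V U hUV z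
  have hpt : (⟨(affineBlowup.π I).base (U.2.fromSpec.base z), hUV (PointCentreIdealSheaf.fromSpec_mem U.2 z)⟩ :
      (V : (Spec (CommRingCat.of R)).Opens)) = ⟨(affineBlowup.π I).base x', hUV hx'⟩ :=
    Subtype.ext (congrArg (fun y => (affineBlowup.π I).base y) hfz)
  rw [hpt] at h1
  have h2 : (V.2.primeIdealOf ⟨(affineBlowup.π I).base x', hUV hx'⟩).asIdeal =
      ((affineBlowup.π I).base x').asIdeal.map (Scheme.ΓSpecIso (CommRingCat.of R)).inv.hom :=
    FibreIdealOfOrigin.primeIdealOf_top_asIdeal (CommRingCat.of R) _ _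
  rw [hfac, ← Ideal.comap_comap, ← Ideal.comap_comap, key, h1, h2]
  exact Ideal.comap_map_of_bijective _ (ConcreteCategory.bijective_of_isIso (Scheme.ΓSpecIso (CommRingCat.of R)).inv)

/-- **THE DEFINING CHART OF `ξ`** (cert `bad_closed_set.defining_chart` / `ideal`): every prime `Q ⊆ R[I/a]` is `𝔭_ξ·e` for a point
`ξ ∈ D₊(at)`, and the base point of `ξ` is `Q ∩ R` (so `π ξ = b` iff `Q ∩ R = 𝔭_b` — the frame's `hξ`). [folklore] -/
theorem exists_point_of_prime
    (e : Γ(affineBlowup I, Proj.basicOpen (reesGrading I) (reesT a ha)) ≃+* blowupAlgebra I a)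
    (he : ∀ r : R, e ((affineBlowup.π I).appLE ⊤ (Proj.basicOpen (reesGrading I) (reesT a ha)) le_top
      ((Scheme.ΓSpecIso (CommRingCat.of R)).inv r)) = algebraMap R (blowupAlgebra I a) r)
    (Q : PrimeSpectrum (blowupAlgebra I a)) :
    ∃ (ξ : ↥(affineBlowup I)) (hξ : ξ ∈ Proj.basicOpen (reesGrading I) (reesT a ha)),
      ((⟨Proj.basicOpen (reesGrading I) (reesT a ha), AffineBlowupChartFrame.isAffineOpen_basicOpen_reesT I a ha⟩ :
          (affineBlowup I).affineOpens).2.primeIdealOf ⟨ξ, hξ⟩).asIdeal.map e = Q.asIdeal ∧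
        ((affineBlowup.π I).base ξ).asIdeal = Q.asIdeal.comap (algebraMap R (blowupAlgebra I a)) := by
  obtain ⟨ξ, hξ, hmap⟩ := exists_map_primeIdealOf_eq
    (⟨Proj.basicOpen (reesGrading I) (reesT a ha), AffineBlowupChartFrame.isAffineOpen_basicOpen_reesT I a ha⟩ :
      (affineBlowup I).affineOpens) e Q
  refine ⟨ξ, hξ, hmap, ?_⟩
  rw [← hmap, comap_algebraMap_map_primeIdealOf I a ha e he ξ hξ]

end DefiningChart

/-! ## §2 The restriction lemma: `𝔭_ξ` read on another chart, from memberships -/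

section Restriction

universe u

variable {R : Type u} [CommRing R] {I : Ideal R} {a b : R} {ha : a ∈ I} {hb : b ∈ I}

/-- **A chart misses `ξ` iff the overlap unit lies in `𝔭_ξ`**: for `ξ ∈ D₊(at)` and `c ∈ I`, `ξ ∉ D₊(ct) ↔ c/a ∈ 𝔭_ξ·e_a`
(`AffineBlowupChartTransport.mem_basicOpen_symm_div_iff`). On such charts `𝓘(closure {ξ}).ideal = ⊤` (N5b `ideal_eq_top`). [folklore] -/
theorem not_mem_basicOpen_iff_div_mem
    (ea : Γ(affineBlowup I, Proj.basicOpen (reesGrading I) (reesT a ha)) ≃+* blowupAlgebra I a)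
    (hea : ∀ g : Away (reesGrading I) (reesT a ha),
      ea ((Proj.basicOpenIsoAway (reesGrading I) (reesT a ha) (reesT_mem a ha) Nat.one_pos).hom g) = reesChartEquiv a ha g)
    (ξ : ↥(affineBlowup I)) (hξa : ξ ∈ Proj.basicOpen (reesGrading I) (reesT a ha)) (c : R) (hc : c ∈ I) :
    ξ ∉ Proj.basicOpen (reesGrading I) (reesT c hc) ↔
      (⟨algebraMap R (Localization.Away a) c * IsLocalization.Away.invSelf a, div_mem_blowupAlgebra I a hc⟩ : blowupAlgebra I a) ∈
        ((⟨Proj.basicOpen (reesGrading I) (reesT a ha), AffineBlowupChartFrame.isAffineOpen_basicOpen_reesT I a ha⟩ :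
          (affineBlowup I).affineOpens).2.primeIdealOf ⟨ξ, hξa⟩).asIdeal.map ea := by
  rw [← AffineBlowupChartTransport.mem_basicOpen_symm_div_iff ea hea c hc ξ hξa, ← Ideal.symm_apply_mem_of_equiv_iff]
  exact (AffineBlowupChartTransport.mem_primeIdealOf_iff_not_mem_basicOpen
    (⟨Proj.basicOpen (reesGrading I) (reesT a ha), AffineBlowupChartFrame.isAffineOpen_basicOpen_reesT I a ha⟩ :
      (affineBlowup I).affineOpens) hξa _).symm

/-- **THE RESTRICTION LEMMA — `𝔭_ξ` read on the chart `D₊(bt)` equals the candidate prime `P`, from memberships.** `ξ` a point of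
`D₊(at) ∩ D₊(bt)`; `ea`, `eb` the pinned sections isomorphisms (`AffineBlowupChartTransport.exists_sectionsEquiv_eq`); `𝔭_ξ·e_a`
generated (at least) by the `x_i/(at)^{n_i}` (numerator form); `P ⊆ R[I/b]` prime, `a/b ∉ P`, contained in the span of the
`x′_j/(bt)^{m_j}`; (h1) `x′_j/(at)^{m_j} ∈ 𝔭_ξ·e_a`; (h2) `x_i/(bt)^{n_i} ∈ P`. Then `𝔭_ξ·e_b = P`. See the module docstring for
the proof (generic point of `P` + overlap + point readings + N5b). [folklore] -/
theorem map_primeIdealOf_eq_of_memberships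
    (ea : Γ(affineBlowup I, Proj.basicOpen (reesGrading I) (reesT a ha)) ≃+* blowupAlgebra I a)
    (hea : ∀ g : Away (reesGrading I) (reesT a ha),
      ea ((Proj.basicOpenIsoAway (reesGrading I) (reesT a ha) (reesT_mem a ha) Nat.one_pos).hom g) = reesChartEquiv a ha g)
    (eb : Γ(affineBlowup I, Proj.basicOpen (reesGrading I) (reesT b hb)) ≃+* blowupAlgebra I b)
    (heb : ∀ g : Away (reesGrading I) (reesT b hb),
      eb ((Proj.basicOpenIsoAway (reesGrading I) (reesT b hb) (reesT_mem b hb) Nat.one_pos).hom g) = reesChartEquiv b hb g)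
    (ξ : ↥(affineBlowup I)) (hξa : ξ ∈ Proj.basicOpen (reesGrading I) (reesT a ha))
    (hξb : ξ ∈ Proj.basicOpen (reesGrading I) (reesT b hb))
    -- generators of `𝔭_ξ` read on the chart `D₊(at)`, numerator form
    {k : ℕ} (n : Fin k → ℕ) (x : Fin k → reesAlgebra I) (hx : ∀ i, x i ∈ reesGrading I (n i • 1))
    (hQa : ((⟨Proj.basicOpen (reesGrading I) (reesT a ha), AffineBlowupChartFrame.isAffineOpen_basicOpen_reesT I a ha⟩ :
          (affineBlowup I).affineOpens).2.primeIdealOf ⟨ξ, hξa⟩).asIdeal.map ea ≤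
      Ideal.span (Set.range fun i : Fin k =>
        reesChartEquiv a ha (HomogeneousLocalization.Away.mk (reesGrading I) (reesT_mem a ha) (n i) (x i) (hx i))))
    -- the candidate prime on the chart `D₊(bt)`, avoiding the overlap unit `a/b`, numerator-form generators
    (P : Ideal (blowupAlgebra I b)) [P.IsPrime]
    (haP : (⟨algebraMap R (Localization.Away b) a * IsLocalization.Away.invSelf b, div_mem_blowupAlgebra I b ha⟩ :
      blowupAlgebra I b) ∉ P)
    {l : ℕ} (m : Fin l → ℕ) (x' : Fin l → reesAlgebra I) (hx' : ∀ j, x' j ∈ reesGrading I (m j • 1))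
    (hP : P ≤ Ideal.span (Set.range fun j : Fin l =>
      reesChartEquiv b hb (HomogeneousLocalization.Away.mk (reesGrading I) (reesT_mem b hb) (m j) (x' j) (hx' j))))
    -- the memberships
    (h1 : ∀ j : Fin l, reesChartEquiv a ha (HomogeneousLocalization.Away.mk (reesGrading I) (reesT_mem a ha) (m j) (x' j) (hx' j)) ∈
      ((⟨Proj.basicOpen (reesGrading I) (reesT a ha), AffineBlowupChartFrame.isAffineOpen_basicOpen_reesT I a ha⟩ :
          (affineBlowup I).affineOpens).2.primeIdealOf ⟨ξ, hξa⟩).asIdeal.map ea)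
    (h2 : ∀ i : Fin k, reesChartEquiv b hb (HomogeneousLocalization.Away.mk (reesGrading I) (reesT_mem b hb) (n i) (x i) (hx i)) ∈ P) :
    ((⟨Proj.basicOpen (reesGrading I) (reesT b hb), AffineBlowupChartFrame.isAffineOpen_basicOpen_reesT I b hb⟩ :
        (affineBlowup I).affineOpens).2.primeIdealOf ⟨ξ, hξb⟩).asIdeal.map eb = P := by
  set Ua : (affineBlowup I).affineOpens :=
    ⟨Proj.basicOpen (reesGrading I) (reesT a ha), AffineBlowupChartFrame.isAffineOpen_basicOpen_reesT I a ha⟩ with hUa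
  set Ub : (affineBlowup I).affineOpens :=
    ⟨Proj.basicOpen (reesGrading I) (reesT b hb), AffineBlowupChartFrame.isAffineOpen_basicOpen_reesT I b hb⟩ with hUb
  apply le_antisymm
  · -- `𝔭_ξ·e_b ≤ P`: through the generic point `η` of `P`
    obtain ⟨η, hηb, hη⟩ := exists_map_primeIdealOf_eq Ub eb ⟨P, inferInstance⟩
    change (Ub.2.primeIdealOf ⟨η, hηb⟩).asIdeal.map eb = P at hη
    -- `η ∈ D₊(at)`: `a/b ∉ P = 𝔭_η·e_b`, and `D(e_b⁻¹(a/b)) = D₊(bt) ⊓ D₊(at)`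
    have hηa : η ∈ Proj.basicOpen (reesGrading I) (reesT a ha) := by
      refine (AffineBlowupChartTransport.mem_basicOpen_symm_div_iff eb heb a ha η hηb).mp ?_
      by_contra hD
      apply haP
      rw [← hη, ← Ideal.symm_apply_mem_of_equiv_iff]
      exact (AffineBlowupChartTransport.mem_primeIdealOf_iff_not_mem_basicOpen Ub hηb _).mpr hD
    -- `η ∈ closure {ξ}`: on the chart `D₊(at)`, `𝔭_ξ ≤ 𝔭_η` since the generators `x_i/(at)^{n_i}` lie in `𝔭_η·e_a`
    have hcl : η ∈ closure ({ξ} : Set ↥(affineBlowup I)) := by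
      rw [← IdealSheafOfPointClosure.primeIdealOf_le_iff_mem_closure Ua ξ hξa η hηa,
        ← AffineBlowupChartTransport.map_le_map_iff_of_ringEquiv ea]
      refine hQa.trans ?_
      rw [Ideal.span_le]
      rintro _ ⟨i, rfl⟩
      -- `x_i/(bt)^{n_i} ∈ P = 𝔭_η·e_b` ⇒ `x_i ∈ η` ⇒ `x_i/(at)^{n_i} ∈ 𝔭_η·e_a`
      have hib : eb.symm (reesChartEquiv b hb (HomogeneousLocalization.Away.mk (reesGrading I) (reesT_mem b hb) (n i) (x i)
          (hx i))) ∈ (Ub.2.primeIdealOf ⟨η, hηb⟩).asIdeal := by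
        rw [Ideal.symm_apply_mem_of_equiv_iff, hη]
        exact h2 i
      have hxη : x i ∈ η.asHomogeneousIdeal :=
        (AffineBlowupChartTransport.symm_mk_mem_primeIdealOf_iff eb heb η hηb (n i) (x i) (hx i)).mp hib
      exact Ideal.symm_apply_mem_of_equiv_iff.mp
        ((AffineBlowupChartTransport.symm_mk_mem_primeIdealOf_iff ea hea η hηa (n i) (x i) (hx i)).mpr hxη)
    -- hence `𝔭_ξ ≤ 𝔭_η` on the chart `D₊(bt)` too
    have hle : (Ub.2.primeIdealOf ⟨ξ, hξb⟩).asIdeal ≤ (Ub.2.primeIdealOf ⟨η, hηb⟩).asIdeal :=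
      (IdealSheafOfPointClosure.primeIdealOf_le_iff_mem_closure Ub ξ hξb η hηb).mpr hcl
    rw [← hη]
    exact Ideal.map_mono hle
  · -- `P ≤ 𝔭_ξ·e_b`: each generator `x′_j/(bt)^{m_j}` has `x′_j ∈ ξ` by (h1)
    refine hP.trans ?_
    rw [Ideal.span_le]
    rintro _ ⟨j, rfl⟩
    have hja : ea.symm (reesChartEquiv a ha (HomogeneousLocalization.Away.mk (reesGrading I) (reesT_mem a ha) (m j) (x' j)
        (hx' j))) ∈ (Ua.2.primeIdealOf ⟨ξ, hξa⟩).asIdeal :=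
      Ideal.symm_apply_mem_of_equiv_iff.mpr (h1 j)
    have hxξ : x' j ∈ ξ.asHomogeneousIdeal :=
      (AffineBlowupChartTransport.symm_mk_mem_primeIdealOf_iff ea hea ξ hξa (m j) (x' j) (hx' j)).mp hja
    exact Ideal.symm_apply_mem_of_equiv_iff.mp
      ((AffineBlowupChartTransport.symm_mk_mem_primeIdealOf_iff eb heb ξ hξb (m j) (x' j) (hx' j)).mpr hxξ)

/-! ## §3 Ideal-sheaf forms (the frame's `J₂ = 𝓘(closure {ξ})`) -/

/-- **`(𝓘(closure {ξ}).ideal D₊(bt))·e_b = P`** under the hypotheses of `map_primeIdealOf_eq_of_memberships` — the equation-style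
guard `hJ` of `AffineBlowupChartTransport.chartClause_transport` for a chart MEETING the bad curve (N5b `ideal_eq_primeIdealOf`).
[folklore] -/
theorem map_ideal_closure_eq_of_memberships
    (ea : Γ(affineBlowup I, Proj.basicOpen (reesGrading I) (reesT a ha)) ≃+* blowupAlgebra I a)
    (hea : ∀ g : Away (reesGrading I) (reesT a ha),
      ea ((Proj.basicOpenIsoAway (reesGrading I) (reesT a ha) (reesT_mem a ha) Nat.one_pos).hom g) = reesChartEquiv a ha g)
    (eb : Γ(affineBlowup I, Proj.basicOpen (reesGrading I) (reesT b hb)) ≃+* blowupAlgebra I b)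
    (heb : ∀ g : Away (reesGrading I) (reesT b hb),
      eb ((Proj.basicOpenIsoAway (reesGrading I) (reesT b hb) (reesT_mem b hb) Nat.one_pos).hom g) = reesChartEquiv b hb g)
    (ξ : ↥(affineBlowup I)) (hξa : ξ ∈ Proj.basicOpen (reesGrading I) (reesT a ha))
    (hξb : ξ ∈ Proj.basicOpen (reesGrading I) (reesT b hb))
    {k : ℕ} (n : Fin k → ℕ) (x : Fin k → reesAlgebra I) (hx : ∀ i, x i ∈ reesGrading I (n i • 1))
    (hQa : ((⟨Proj.basicOpen (reesGrading I) (reesT a ha), AffineBlowupChartFrame.isAffineOpen_basicOpen_reesT I a ha⟩ :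
          (affineBlowup I).affineOpens).2.primeIdealOf ⟨ξ, hξa⟩).asIdeal.map ea ≤
      Ideal.span (Set.range fun i : Fin k =>
        reesChartEquiv a ha (HomogeneousLocalization.Away.mk (reesGrading I) (reesT_mem a ha) (n i) (x i) (hx i))))
    (P : Ideal (blowupAlgebra I b)) [P.IsPrime]
    (haP : (⟨algebraMap R (Localization.Away b) a * IsLocalization.Away.invSelf b, div_mem_blowupAlgebra I b ha⟩ :
      blowupAlgebra I b) ∉ P)
    {l : ℕ} (m : Fin l → ℕ) (x' : Fin l → reesAlgebra I) (hx' : ∀ j, x' j ∈ reesGrading I (m j • 1))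
    (hP : P ≤ Ideal.span (Set.range fun j : Fin l =>
      reesChartEquiv b hb (HomogeneousLocalization.Away.mk (reesGrading I) (reesT_mem b hb) (m j) (x' j) (hx' j))))
    (h1 : ∀ j : Fin l, reesChartEquiv a ha (HomogeneousLocalization.Away.mk (reesGrading I) (reesT_mem a ha) (m j) (x' j) (hx' j)) ∈
      ((⟨Proj.basicOpen (reesGrading I) (reesT a ha), AffineBlowupChartFrame.isAffineOpen_basicOpen_reesT I a ha⟩ :
          (affineBlowup I).affineOpens).2.primeIdealOf ⟨ξ, hξa⟩).asIdeal.map ea)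
    (h2 : ∀ i : Fin k, reesChartEquiv b hb (HomogeneousLocalization.Away.mk (reesGrading I) (reesT_mem b hb) (n i) (x i) (hx i)) ∈ P) :
    ((Scheme.IdealSheafData.vanishingIdeal (⟨closure ({ξ} : Set ↥(affineBlowup I)), isClosed_closure⟩ :
        Closeds ↥(affineBlowup I))).ideal
      ⟨Proj.basicOpen (reesGrading I) (reesT b hb), AffineBlowupChartFrame.isAffineOpen_basicOpen_reesT I b hb⟩).map eb = P := by
  rw [IdealSheafOfPointClosure.ideal_eq_primeIdealOf ξ
    ⟨Proj.basicOpen (reesGrading I) (reesT b hb), AffineBlowupChartFrame.isAffineOpen_basicOpen_reesT I b hb⟩ hξb]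
  exact map_primeIdealOf_eq_of_memberships ea hea eb heb ξ hξa hξb n x hx hQa P haP m x' hx' hP h1 h2

/-- **The defining chart itself**: `(𝓘(closure {ξ}).ideal D₊(at))·e_a = 𝔭_ξ·e_a` (N5b) — recorded in the `map` currency of the
guards, so that with §1 `exists_point_of_prime` (`𝔭_ξ·e_a = Q`) the instance reads `(𝓘(closure {ξ}).ideal D₊(at))·e_a = Q`. [folklore] -/
theorem map_ideal_closure_eq_map_primeIdealOf
    (ea : Γ(affineBlowup I, Proj.basicOpen (reesGrading I) (reesT a ha)) ≃+* blowupAlgebra I a)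
    (ξ : ↥(affineBlowup I)) (hξa : ξ ∈ Proj.basicOpen (reesGrading I) (reesT a ha)) :
    ((Scheme.IdealSheafData.vanishingIdeal (⟨closure ({ξ} : Set ↥(affineBlowup I)), isClosed_closure⟩ :
        Closeds ↥(affineBlowup I))).ideal
      ⟨Proj.basicOpen (reesGrading I) (reesT a ha), AffineBlowupChartFrame.isAffineOpen_basicOpen_reesT I a ha⟩).map ea =
      ((⟨Proj.basicOpen (reesGrading I) (reesT a ha), AffineBlowupChartFrame.isAffineOpen_basicOpen_reesT I a ha⟩ :
          (affineBlowup I).affineOpens).2.primeIdealOf ⟨ξ, hξa⟩).asIdeal.map ea := by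
  rw [IdealSheafOfPointClosure.ideal_eq_primeIdealOf ξ
    ⟨Proj.basicOpen (reesGrading I) (reesT a ha), AffineBlowupChartFrame.isAffineOpen_basicOpen_reesT I a ha⟩ hξa]

/-- **Charts missing `ξ`**: if `c/a ∈ 𝔭_ξ·e_a` then `𝓘(closure {ξ}).ideal D₊(ct) = ⊤` (so the frame's guard `¬ J₂.ideal (U c) ≤ Q` is
automatic there). [folklore] -/
theorem ideal_closure_eq_top_of_div_mem
    (ea : Γ(affineBlowup I, Proj.basicOpen (reesGrading I) (reesT a ha)) ≃+* blowupAlgebra I a)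
    (hea : ∀ g : Away (reesGrading I) (reesT a ha),
      ea ((Proj.basicOpenIsoAway (reesGrading I) (reesT a ha) (reesT_mem a ha) Nat.one_pos).hom g) = reesChartEquiv a ha g)
    (ξ : ↥(affineBlowup I)) (hξa : ξ ∈ Proj.basicOpen (reesGrading I) (reesT a ha)) (c : R) (hc : c ∈ I)
    (hmem : (⟨algebraMap R (Localization.Away a) c * IsLocalization.Away.invSelf a, div_mem_blowupAlgebra I a hc⟩ : blowupAlgebra I a) ∈
      ((⟨Proj.basicOpen (reesGrading I) (reesT a ha), AffineBlowupChartFrame.isAffineOpen_basicOpen_reesT I a ha⟩ :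
          (affineBlowup I).affineOpens).2.primeIdealOf ⟨ξ, hξa⟩).asIdeal.map ea) :
    (Scheme.IdealSheafData.vanishingIdeal (⟨closure ({ξ} : Set ↥(affineBlowup I)), isClosed_closure⟩ :
        Closeds ↥(affineBlowup I))).ideal
      ⟨Proj.basicOpen (reesGrading I) (reesT c hc), AffineBlowupChartFrame.isAffineOpen_basicOpen_reesT I c hc⟩ = ⊤ :=
  IdealSheafOfPointClosure.ideal_eq_top ξ _ ((not_mem_basicOpen_iff_div_mem ea hea ξ hξa c hc).mpr hmem)

/-! ## §4 The hon charts cover the bad curve (the cert's `cover_certificates` ⇒ the frame's `hScover`) -/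

/-- **`closure {ξ} ⊆ ⋃_{c ∈ S} D₊(x_c t)` from Bezout certificates.** Charts `D₊(x_c t)` of a radical sub-cover (`R[It]₊ ⊆ √(x_c t)_c`,
so they cover `Bl_I(Spec R)`), pinned sections isomorphisms `e c`, and for EVERY chart `c` one of: `c ∈ S`; or `ξ ∉ D₊(x_c t)` (the chart
misses the curve; e.g. by `not_mem_basicOpen_iff_div_mem`); or a Bezout certificate `(x_{σ i}/x_c)_i + (𝓘(closure {ξ}).ideal D₊(x_c t))·e c
= R[I/x_c]` with all `σ i ∈ S` (`AffineBlowupChartTransport.exists_mem_basicOpen_of_mem_support`). Then every point of `closure {ξ}` lies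
in a chart of `S` — the binder `hScover` of `TwoLevelFrame.pointFixable_of_twoLevelData`. [folklore] -/
theorem exists_mem_of_mem_closure_of_bezout {N : ℕ} (xg : Fin N → R) (hxg : ∀ c, xg c ∈ I)
    (hcov : (HomogeneousIdeal.irrelevant (reesGrading I)).toIdeal ≤
      (Ideal.span (Set.range fun c : Fin N => reesT (I := I) (xg c) (hxg c))).radical)
    (e : ∀ c : Fin N, Γ(affineBlowup I, Proj.basicOpen (reesGrading I) (reesT (xg c) (hxg c))) ≃+* blowupAlgebra I (xg c))
    (he : ∀ (c : Fin N) (g : Away (reesGrading I) (reesT (xg c) (hxg c))),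
      e c ((Proj.basicOpenIsoAway (reesGrading I) (reesT (xg c) (hxg c)) (reesT_mem (xg c) (hxg c)) Nat.one_pos).hom g) =
        reesChartEquiv (xg c) (hxg c) g)
    (ξ : ↥(affineBlowup I)) (S : Set (Fin N))
    (hbez : ∀ c : Fin N, c ∈ S ∨ ξ ∉ Proj.basicOpen (reesGrading I) (reesT (xg c) (hxg c)) ∨
      ∃ (m : ℕ) (σ : Fin m → Fin N), (∀ i, σ i ∈ S) ∧
        Ideal.span (Set.range fun i : Fin m => (⟨algebraMap R (Localization.Away (xg c)) (xg (σ i)) *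
            IsLocalization.Away.invSelf (xg c), div_mem_blowupAlgebra I (xg c) (hxg (σ i))⟩ : blowupAlgebra I (xg c))) ⊔
          ((Scheme.IdealSheafData.vanishingIdeal (⟨closure ({ξ} : Set ↥(affineBlowup I)), isClosed_closure⟩ :
              Closeds ↥(affineBlowup I))).ideal
            ⟨Proj.basicOpen (reesGrading I) (reesT (xg c) (hxg c)),
              AffineBlowupChartFrame.isAffineOpen_basicOpen_reesT I (xg c) (hxg c)⟩).map (e c) = ⊤) :
    ∀ x' : ↥(affineBlowup I), x' ∈ closure ({ξ} : Set ↥(affineBlowup I)) →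
      ∃ c ∈ S, x' ∈ (Proj.basicOpen (reesGrading I) (reesT (xg c) (hxg c)) : (affineBlowup I).Opens) := by
  intro x' hx'
  obtain ⟨c, hc⟩ := BlowupFiModelOfCover.exists_mem_basicOpen_of_irrelevant_le_radical xg hxg hcov x'
  rcases hbez c with hcS | hξc | ⟨m, σ, hσS, hsup⟩
  · exact ⟨c, hcS, hc⟩
  · -- the chart misses `ξ`, hence misses `closure {ξ}`: contradiction
    exfalso
    have hempty := IdealSheafOfPointClosure.closure_inter_eq_empty_of_notMem ξ
      (⟨Proj.basicOpen (reesGrading I) (reesT (xg c) (hxg c)), AffineBlowupChartFrame.isAffineOpen_basicOpen_reesT I (xg c) (hxg c)⟩ :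
        (affineBlowup I).affineOpens) hξc
    exact Set.eq_empty_iff_forall_notMem.mp hempty x' ⟨hx', hc⟩
  · -- Bezout on the chart `c`
    have hsupp : x' ∈ (Scheme.IdealSheafData.vanishingIdeal (⟨closure ({ξ} : Set ↥(affineBlowup I)), isClosed_closure⟩ :
        Closeds ↥(affineBlowup I))).support := by
      rw [← SetLike.mem_coe, IdealSheafOfPointClosure.coe_support]
      exact hx'
    obtain ⟨i, hi⟩ := AffineBlowupChartTransport.exists_mem_basicOpen_of_mem_support (e c) (he c) _ x' hc hsupp
      (fun i => xg (σ i)) (fun i => hxg (σ i)) hsup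
    exact ⟨σ i, hσS i, hi⟩

end Restriction

end Summit.ResolutionOfSingularities.ResolutionOfSingularities.Theorems.FInjectiveMacaulayfication.AffineBlowupChartRestriction

end
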